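/-
Copyright (c) 2026 the pub-hodgecm-mathlib formalisation cell (harness21).  Prover seat hodgecm-mathlib-LH7-p10 (g3), req620 Track A «(D-RAM) FOUR-FRAME» squad
((β₂) road (R-36) «PURE-CELL LEDGER», lane C = type RamM, β₂ sub-dealer LH4-p04 (g10) 🃏«GO» 03:09:15Z «LH7-p10: START F4-RamM», LANEC-RAY-PROGRAM.v2 file G8: the
lane-C UPPER-LINE RAY ∩ LOW CELL WORKER on the DIAGONAL parity branch, paying ‹HU_RAY_C♮-diag›), helper lane on h413 = stmt-HodgeConjecture-24833 (count-neutral).  2026-09-05.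
-/
import Summits.HodgeConjecture.HodgeConjecture.Theorems.F0P3cDyRamBeta2ConesOffRowUpperRayWorker      -- ★ p864702 (LH4-p19 (g3)): lane B's worker — brings the whole lane-free RAY kit (★ R1b-A §2–§3, ★ W1 §2, ★ F1, ★ p863983, ★ LH7-p06, ★ p864080, ★ class systems, ★ wild unit)
import Summits.HodgeConjecture.HodgeConjecture.Theorems.F0P3cDyRamBeta2ConesOffRowCUpperExactLevel    -- ★ p864388 (this seat, C5): the consumer of ‹HU_RAY_C♮›; brings ‹OFF_C.letter.v2›'s vocabulary, ★ p863549 bridge, ★ p863632 `depth_even_of_letters_ramM`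
import Summits.HodgeConjecture.HodgeConjecture.Theorems.F0P3cDyRamRamMFrameClassLettersOfBlock        -- ★ G1 (this seat): `fgap_of_fixedFixed`, `exists_refPair_ramM`, `refPair_cell_sizes`; brings ★ F4 `deep_of_datum`, `dich_of_datum`
import Summits.HodgeConjecture.HodgeConjecture.Theorems.F0P3cDyRamUpperRayCellLettersDiag              -- ★ G4′ (this seat): `exists_cellLetters_of_tokens_diag`; brings ★ G4, ★ `v_map_le_pow_iff`, ★ `v_map_eq_one_iff`
import Summits.HodgeConjecture.HodgeConjecture.Theorems.F0P3cDyRamConeCellCountSocketRadii            -- ★ p864732 (this seat): the count socket with radii `cellDiff_eq_zero_of_fibration_reads₄_radii`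
import Summits.HodgeConjecture.HodgeConjecture.Theorems.F0P3cDyRamUpperRayCellReadsGen                 -- ★ G2 (LH4-p19 (g3)): `exists_vertexFrame_of_gen` with `hjv`
import Summits.HodgeConjecture.HodgeConjecture.Theorems.F0P3cDyRamUpperRayDigitConstancyRadius         -- ★ G3′ (LH7-p06 (g3)): `litStar_iff_of_near_of_radius`
import Summits.HodgeConjecture.HodgeConjecture.Theorems.F0P3cDyRamRowCellGeneratorIndependenceRadius  -- ★ P6′ (LH7-p06 (g3)): `cls_iff_cls_and_v_sub_le_of_gen_of_radius`
import Summits.HodgeConjecture.HodgeConjecture.Theorems.F0P3cDyRamRowCellSocketFibreGen                -- ★ G5 (LH7-p06 (g3)): `fibre_ncard_eq_of_lit_of_gen` with `|jEϖ| < 1`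
import Summits.HodgeConjecture.HodgeConjecture.Theorems.F0P3cDyRamUpperRayCellLiteralReadsRadius       -- ★ G6′ (LH4-p19 (g3)): `reads_of_gen6_of_radius`
import HarnessLib

/-!
# Crux `H413`, line LH4 «(D-RAM) FOUR-FRAME» — the (β₂) road (R-36), (OFF_C) residue, lane C (type RamM): «THE UPPER-LINE RAY ∩ LOW CELL WORKER, DIAGONAL BRANCH» — on a cell
# `(j, b)` of the lane-C top line with `j + 1 = b + s0` (RAY `2m⋆ + 2b ≤ m`, LOW `2b + m_c ≤ m`, `m < 4b`, `1 ≤ b ≤ j`) the weighted (β₂) labelled difference of the (OFF_C) residue's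
# two exact-level literals vanishes — the digit regime `|κ̂| = |κ₀|`, run at resolution `b + 1`; with ★ G7 (generic branch) and ★ G9 (glue) this PAYS ‹HU_RAY_C♮›

Cell `hodgecm-mathlib` (D-0151), FLOOR 0, crux item H413 = `stmt-HodgeConjecture-24833`, route of record `HCCMUnconditional`; squads F0∕P3c∕LH4 ∕ LH7; lane
`--supports stmt-HodgeConjecture-24833 --as helper` (count-neutral; pays NO tier-0 row).  THEOREMS ONLY (no `def`, no instance, no notation, no `sorry`, default heartbeats);
★-only imports; states NO law; (β₂) stays a HYPOTHESIS.  Binders = `N` with the chain-of-record floor `2·m_c ≤ N d t`, then ‹OFF_C.letter.v2› (a2c0234d) BYTE FOR BYTE, then the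
cell tail of ‹HU_RAY_C♮› with the parity letter RESTRICTED to `j + 1 = b + s0` — i.e. the statement is ‹HU_RAY_C♮-diag› (HOME g3 `HU_RAY_Cnat_diag.letter.v1`, 47c8c4c0).

WHY (LANEC-RAY-PROGRAM.v2-G8 §0).  On the diagonal `|κ̂| = e^{2d′−2} = |κ₀|` for every vertex (★ G1), the pair at `n = 0` has `|ξ₀|·|cc| = |jEϖ|^{b−1}` (★ G1 `refPair_diag_sizes`),
the centre sits one digit below the reference (`|κ_c| = e^{jl−m} = |ξ₀|·|jEϖ|`; cell letters ★ G4′), and two generators of one member move the digit by at most the INTRINSIC radius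
`|jEϖ|^{2b}∕(|ξ₀|·|cc|) = |jEϖ|^{b+1}` (★ P6′): ★ G7's assembly re-run at RESOLUTION `b + 1` — `rM = |jEϖ|^{b+1}`, `rE = |ϖ|^{b+1}`, class system at `b + 1`, ★ F1 at `n := b + 1`
(same `ρ = mE − b − ℓ₀`), ★ p863983 ∕ ★ G5 at `r = |jEϖ|^{b+1}`, `r₀ = |jEϖ|^b`, ★ G3′ in M-currency (`|V′ − V| ≤ |ϖ|^{2d}` from ★ G4′'s `|ϖ|^{2d−2} ≤ |γ₁|·|ϖ|^{2d}`), ★ G6′ at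
`k := b + 1`; the rest (★ G2, ★ `dep_iff_ball`, ★ `weight_ne_zero_iff_cls_of_gen6`, ★ W1 §2, ★ p864080, ★ p864732, `m = 2mE` by ★ `depth_even_of_letters_ramM`) as in ★ G7.
* HEAD `cellDiff_topLine_rayDiag_eq_zero_ramM (N) (hN)` : ‹HU_RAY_C♮-diag›; with ★ G7 and ★ G9: `offRowCU_ray_of_gen_of_diag N (★ G7 N hN) (HEAD N hN) : ‹HU_RAY_C♮›` (file `…UpperRayHolds`).
HONEST LABEL.  Count-neutral; nothing printed is asserted; no census law is stated; ‹HU_MIX_C♮›, ‹HL_*›, ‹HC_*› remain binders of ★ C4–C6's consumers; `HC_CM` is proved only modulo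
the 7 printed citations (2 remaining named inputs: hLiu418 = `stmt-HodgeConjecture-24832`, h413 = `stmt-HodgeConjecture-24833`) until rung 0 closes.
## References
* [Kottwitz1986BaseChangeUnits] R. E. Kottwitz, *Base change for unit elements of Hecke algebras*, Compositio Math. 60 (1986): §1 pp. 240–241, §3.  [Jacobowitz1962] R. Jacobowitz, *Hermitian forms over local fields*, Amer. J. Math. 84 (1962): §4.
* [Rogawski1990] J. D. Rogawski, *Automorphic Representations of Unitary Groups in Three Variables*, Ann. of Math. Stud. 123 (1990): §4.9 Prop. 4.9.1 (b) p. 55, §12.2.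
* [Serre1979] J.-P. Serre, *Local Fields*, GTM 67 (1979): Ch. III §3 Prop. 7; Ch. III §6 Prop. 12; Ch. V §3 Cor. 3; Ch. XV §2.
-/

set_option autoImplicit false

noncomputable section

namespace Summit.HodgeConjecture.HodgeConjecture.Cruxes.H413.F0P3cDyRamBeta2ConesOffRowCUpperRayDiag

open scoped Valued WithZero Matrix MatrixGroups Pointwise Classical
open WithZero Finset
open Literature.NumberTheory.Automorphic Literature.NumberTheory.Automorphic.HermitianLattice Literature.NumberTheory.Automorphic.UnitaryLatticeTree
open Literature.NumberTheory.Automorphic.UnitaryGroup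
open Literature.NumberTheory.Automorphic.UnitaryThreeFourFrame (IsRamifiedQuadraticDatum normSign)
open Literature.NumberTheory.Rogawski1990
open Summit.HodgeConjecture.HodgeConjecture.Cruxes.H413.F0P3cDyRamFourFramePieces
open Summit.HodgeConjecture.HodgeConjecture.Cruxes.H413.F0P3cDyRamFourFrameCensusDefs (LatticeInLevel LatticeNearTransvShell)
open Summit.HodgeConjecture.HodgeConjecture.Cruxes.H413.F0P3cDyRamStageOneBDefs (mcOfRecord)
open Summit.HodgeConjecture.HodgeConjecture.Cruxes.H413.F0P3cDyRamToricCensusDefs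
open Summit.HodgeConjecture.HodgeConjecture.Cruxes.H413.F0P3cDyRamRowCleanCellBit (line_entry_mul_map_eq_one)
open Summit.HodgeConjecture.HodgeConjecture.Cruxes.H413.F0P3cDyRamPieceRowsWildUnit0OfExports (v_two_lt_one_of_not_isUnit_two)
open Summit.HodgeConjecture.HodgeConjecture.Cruxes.H413.F0P3cDyRamLabelShellFlipCardTwo (v_refSkew_eq)
open Summit.HodgeConjecture.HodgeConjecture.Cruxes.H413.F0P3cDyRamUpperLineRayLetters (isOrd_div_pow_of_le)
open Summit.HodgeConjecture.HodgeConjecture.Cruxes.H413.F0P3cDyRamDiagonalFixedClassSystems (exists_repr_fixedBall_card)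
open Summit.HodgeConjecture.HodgeConjecture.Cruxes.H413.F0P3cDyRamRowCellSocketLit (lit_of_near_of_gen)
open Summit.HodgeConjecture.HodgeConjecture.Cruxes.H413.F0P3cDyRamSphereLabelDigits (card_filter_sphere_plus_eq_card_filter_not)
open Summit.HodgeConjecture.HodgeConjecture.Cruxes.H413.F0P3cDyRamConeCellCountSocketRadii (cellDiff_eq_zero_of_fibration_reads₄_radii)
open Summit.HodgeConjecture.HodgeConjecture.Cruxes.H413.F0P3cDyRamRamKFrameClassLetters (deep_of_datum dich_of_datum)
open Summit.HodgeConjecture.HodgeConjecture.Cruxes.H413.F0P3cDyRamRamMFrameClassLettersOfBlock (fgap_of_fixedFixed exists_refPair_ramM refPair_diag_sizes)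
open Summit.HodgeConjecture.HodgeConjecture.Cruxes.H413.F0P3cDyRamUpperRayCellLettersDiag (exists_cellLetters_of_tokens_diag)
open Summit.HodgeConjecture.HodgeConjecture.Cruxes.H413.F0P3cDyRamUpperRayDigitConstancy (sphere_iff_of_near ball_mul_iff_of_near psi_iff_of_near)
open Summit.HodgeConjecture.HodgeConjecture.Cruxes.H413.F0P3cDyRamRowCellGeneratorIndependenceRadius (cls_iff_cls_and_v_sub_le_of_gen_of_radius)
open Summit.HodgeConjecture.HodgeConjecture.Cruxes.H413.F0P3cDyRamUpperRayCellReads (dep_iff_ball weight_ne_zero_iff_cls_of_gen6)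
open Summit.HodgeConjecture.HodgeConjecture.Cruxes.H413.F0P3cDyRamNormPairsIffFrames (normSign_eq_one_or)
open Summit.HodgeConjecture.HodgeConjecture.Cruxes.H413.F0P3cDyRamDiagonalCellCleanRegime (v_map_le_pow_iff)
open Summit.HodgeConjecture.HodgeConjecture.Cruxes.H413.F0P3cDyRamBoundaryCellLetterCardTwo (v_map_eq_one_iff)
open Summit.HodgeConjecture.HodgeConjecture.Cruxes.H413.F0P3cDyRamUpperLineCellCentre (v_centre_eq)
open Summit.HodgeConjecture.HodgeConjecture.Cruxes.H413.F0P3cDyRamBeta2ConesOffRowCParity (depth_even_of_letters_ramM)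
open Summit.HodgeConjecture.HodgeConjecture.Cruxes.H413.F0P3cDyRamUpperRayCellReadsGen (exists_vertexFrame_of_gen)
open Summit.HodgeConjecture.HodgeConjecture.Cruxes.H413.F0P3cDyRamUpperRayDigitConstancyRadius (litStar_iff_of_near_of_radius)
open Summit.HodgeConjecture.HodgeConjecture.Cruxes.H413.F0P3cDyRamRowCellSocketFibreGen (fibre_ncard_eq_of_lit_of_gen)
open Summit.HodgeConjecture.HodgeConjecture.Cruxes.H413.F0P3cDyRamUpperRayCellLiteralReadsRadius (reads_of_gen6_of_radius)

variable {E M : Type} [Field E] [Valued E ℤᵐ⁰] [Field M] [Valued M ℤᵐ⁰] {ρ Θ : M →+* M} {α : M}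


/-! ## HEAD — the lane-C upper-line RAY ∩ LOW cell worker, diagonal branch -/

/-- **HEAD — «THE LANE-C UPPER-LINE RAY ∩ LOW CELL WORKER, DIAGONAL BRANCH» = ‹HU_RAY_C♮-diag›.**  Binders: `N` with the floor `2·m_c ≤ N d t`; then ‹OFF_C.letter.v2› BYTE FOR
BYTE; then the cell `(j, b)` with `1 ≤ b ≤ j`, `m < 4b`, the top line `jl + 2b = 2j + d_ρ + m`, LOW `2b + m_c ≤ m`, the DIAGONAL parity conjunct `j + 1 = b + s0`, RAY `2m⋆ + 2b ≤ m`,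
`IsOrd(lam)`.  THEN the labelled (β₂) difference of the (OFF_C) residue's two exact-level RAY-band literals over `levelSetDep(j, b; μ)` vanishes (module docstring: resolution `b + 1`).
[cite: Kottwitz1986BaseChangeUnits, §1 pp. 240–241; §3] [cite: Jacobowitz1962, §4] [cite: Rogawski1990, §4.9 Prop. 4.9.1 (b) p. 55] [cite: Serre1979, Ch. V §3 Cor. 3; Ch. XV §2] -/
theorem cellDiff_topLine_rayDiag_eq_zero_ramM (N : ℕ → ℕ → ℕ) (hN : ∀ d t, 2 * mcOfRecord d ≤ N d t) :
      ∀ (E M : Type) [Field E] [Valued E ℤᵐ⁰] [CompleteSpace E] [IsDiscreteValuationRing 𝒪[E]] [Finite 𝓀[E]]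
        [Field M] [Valued M ℤᵐ⁰] [CompleteSpace M] [IsDiscreteValuationRing 𝒪[M]] [Finite 𝓀[M]]
        (σ : E →+* E) (ϖ : E) (d tE : ℕ) (_hD : IsRamifiedQuadraticDatum σ ϖ d tE) (_hσσ : ∀ a, σ (σ a) = a) (_h2 : ¬ IsUnit (2 : 𝒪[E]))
        (jE : E →+* M) (ρ Θ : M →+* M) (α lam : M)
        (_hρρ : ∀ z, ρ (ρ z) = z) (_hvρ : ∀ z, Valued.v (ρ z) = Valued.v z) (_hρj : ∀ a, ρ (jE a) = jE a)
        (_hjv : ∀ a, Valued.v (jE a) ≤ 1 ↔ Valued.v a ≤ 1) (_hjfix : ∀ z : M, ρ z = z ↔ ∃ a, jE a = z) (_hΘj : ∀ a, Θ (jE a) = jE (σ a))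
        (_hΘΘ : ∀ z, Θ (Θ z) = z) (_hΘρ : ∀ z, Θ (ρ z) = ρ (Θ z)) (_hvΘ : ∀ z, Valued.v (Θ z) = Valued.v z)
        (_hα : ρ α ≠ α) (_hα1 : Valued.v α ≤ 1) (_hint : ∀ z : M, Valued.v z ≤ 1 → Valued.v ((z - ρ z) / (α - ρ α)) ≤ 1)
        (_hΘlam : Θ lam * lam = 1) (_hvlam : Valued.v lam = 1) (_hbasis : ∀ z : M, ∃! pq : E × E, z = jE pq.1 + jE pq.2 * lam)
        (_hC : Valued.v (α - ρ α) < 1) (ϖM c₀ n₀ : M) (dρ dΘ dτ g s0 dK d' : ℕ)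
        (_c1 : ∀ a, Valued.v (jE a) = Valued.v a ^ 2) (_c2 : Nat.card 𝓀[M] = Nat.card 𝓀[E]) (_c3 : ∀ z : M, Valued.v z ≤ 1 → Valued.v (z - Θ z) < 1) (_c4 : ∀ z : M, Valued.v z ≤ 1 → Valued.v (z - Θ (ρ z)) < 1)
        (_c5 : Valued.v ϖM = WithZero.exp (-1 : ℤ)) (_c6 : α - ρ α = ϖM - ρ ϖM) (_c7 : IsRamifiedQuadraticDatum ρ ϖM dρ (2 * tE)) (_c8 : IsRamifiedQuadraticDatum Θ ϖM dΘ (2 * tE)) (_c9 : 1 ≤ dτ)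
        (_c10 : Valued.v (ϖM - Θ (ρ ϖM)) = Valued.v ϖM ^ dτ) (_c11 : Θ c₀ = c₀) (_c12 : Valued.v c₀ = 1) (_c13 : ∀ x : M, Θ x = x → Valued.v x = 1 → (∃ z : M, z * Θ z = x) ∨ ∃ z : M, z * Θ z = c₀ * x)
        (_c14 : ∀ f₀ : M, ρ f₀ = f₀ → Θ f₀ = f₀ → Valued.v f₀ = 1 → ∃ z : M, z * Θ z = f₀) (_c15 : Θ n₀ = n₀) (_c16 : Valued.v n₀ = 1) (_c17 : ¬ ∃ z : M, z * Θ z = n₀)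
        (_c18 : ∀ x : M, ρ x = x → Θ (ρ x) = x → x ≠ 0 → ∃ n : ℤ, Valued.v x = WithZero.exp (4 * n)) (_c19 : ∀ z : M, ρ z = z → Θ z = z → z ≠ 0 → ∃ n : ℤ, Valued.v z = WithZero.exp (4 * n))
        (_c20 : ∃ a : M, Θ a = a ∧ Valued.v a = 1 ∧ ¬ ∃ e : M, ρ e = e ∧ e * Θ e = a * ρ a) (_c21 : dΘ = 2 * g) (_c22 : dτ = 2 * s0) (_c23 : 1 ≤ g) (_c24 : 1 ≤ s0) (_c25 : g + s0 = d)
        (_c26 : Valued.v (ϖM * Θ (ρ ϖM) - ρ (ϖM * Θ (ρ ϖM))) = WithZero.exp (-(2 * (dK : ℤ)))) (_c27 : 2 * dK = dρ + 2 * g)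
        (_c28 : Valued.v (ϖM * Θ ϖM - ρ (ϖM * Θ ϖM)) = WithZero.exp (-(2 * (d' : ℤ)))) (_c29 : 2 * d' = dρ + dτ) (_hjpow : ∀ (t : E) (n : ℤ), Valued.v (jE t) = Valued.v (jE ϖ) ^ n ↔ Valued.v t = Valued.v ϖ ^ n)
        (_hEval : ∀ c : M, ρ c = c → c ≠ 0 → Valued.v c ≤ 1 → ∃ n : ℕ, Valued.v c = Valued.v (jE ϖ) ^ n)
        (_hϖmax : ∀ t : M, ρ t = t → Valued.v t < 1 → Valued.v t ≤ Valued.v (jE ϖ))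
        (γ₂ : GL (Fin 2) E) (u : GL (Fin 1) E)
        (_hdet : (γ₂ : Matrix (Fin 2) (Fin 2) E).det * σ (γ₂ : Matrix (Fin 2) (Fin 2) E).det = 1)
        (_htr : (γ₂ : Matrix (Fin 2) (Fin 2) E).trace = (γ₂ : Matrix (Fin 2) (Fin 2) E).det * σ (γ₂ : Matrix (Fin 2) (Fin 2) E).trace)
        (_hirr : ∀ x : E, x * x - (γ₂ : Matrix (Fin 2) (Fin 2) E).trace * x + (γ₂ : Matrix (Fin 2) (Fin 2) E).det ≠ 0)
        (_hlam2 : lam * lam = jE (γ₂ : Matrix (Fin 2) (Fin 2) E).trace * lam - jE (γ₂ : Matrix (Fin 2) (Fin 2) E).det)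
        (_hρlam : ρ lam = jE (γ₂ : Matrix (Fin 2) (Fin 2) E).trace - lam) (m jl : ℕ) (_hm : Valued.v (lam - jE ((u : Matrix (Fin 1) (Fin 1) E) 0 0)) = WithZero.exp (-(m : ℤ)))
        (_hjl : Valued.v ((lam - jE ((u : Matrix (Fin 1) (Fin 1) E) 0 0)) - ρ (lam - jE ((u : Matrix (Fin 1) (Fin 1) E) 0 0))) = WithZero.exp (-(jl : ℤ)))
        (_hs : Valued.v ((γ₂ : Matrix (Fin 2) (Fin 2) E).trace - 2) * Valued.v (ϖ ^ (d % 2)) ≤ Valued.v (ϖ ^ mcOfRecord d))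
        (_hp : Valued.v ((γ₂ : Matrix (Fin 2) (Fin 2) E).det - (γ₂ : Matrix (Fin 2) (Fin 2) E).trace + 1) ≤ Valued.v (ϖ ^ mcOfRecord d))
        (_hNm : N d tE ≤ m) (_hu1N : Valued.v (((u : Matrix (Fin 1) (Fin 1) E) 0 0) - 1) ≤ Valued.v (ϖ ^ N d tE)) (_hlam1 : Valued.v (lam - 1) ≤ Valued.v (jE ϖ ^ N d tE))
        (_hu : Valued.v ((u : Matrix (Fin 1) (Fin 1) E) 0 0) = 1) (_hum : Valued.v (((u : Matrix (Fin 1) (Fin 1) E) 0 0) - 1) ≤ Valued.v (ϖ ^ mstarOfRecord d))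
        (H₂ : Matrix (Fin 2) (Fin 2) E) (hW : E) (_hH₂ : IsUnit H₂.det) (_hH₂σ : (H₂.map σ)ᵀ = H₂) (_hhW : Valued.v hW = 1) (_hhWσ : σ hW = hW)
        (P₁ : GL (Fin 3) E) (_hA : formCongr σ P₁ ((StdForm.antidiagonal 3).over E) = (!![H₂ 0 0, 0, H₂ 0 1; 0, hW, 0; H₂ 1 0, 0, H₂ 1 1] : Matrix (Fin 3) (Fin 3) E))
        (_hΓ : P₁ * endoGL (γ₂, u) * P₁⁻¹ ∈ unitaryGroupOfForm σ ((StdForm.antidiagonal 3).over E))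
        (φ : (Fin 2 → E) →+ M) (h : M) (_hφs : ∀ (c : E) (x : Fin 2 → E), φ (c • x) = jE c * φ x) (_hφi : Function.Injective φ) (_hφo : Function.Surjective φ)
        (_hφγ : ∀ x, φ ((γ₂ : Matrix (Fin 2) (Fin 2) E).mulVec x) = lam * φ x)
        (_hform : ∀ x y, jE (pairing σ H₂ x y) = h * Θ (φ x) * φ y + ρ (h * Θ (φ x) * φ y)) (_hΘh : Θ h = h) (_hh : h ≠ 0)
        (J R : ℕ) (f : ℕ → ℕ → AddSubgroup M → ℕ)
        (_hfinF : {L₃ : Submodule 𝒪[E] (Fin 3 → E) | IsSelfDualLattice σ ϖ (!![H₂ 0 0, 0, H₂ 0 1; 0, hW, 0; H₂ 1 0, 0, H₂ 1 1] : Matrix (Fin 3) (Fin 3) E) L₃ ∧ mapGL (endoGL (γ₂, u)) L₃ = L₃}.Finite)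
        (_hR : ∀ L₃ : Submodule 𝒪[E] (Fin 3 → E), IsSelfDualLattice σ ϖ (!![H₂ 0 0, 0, H₂ 0 1; 0, hW, 0; H₂ 1 0, 0, H₂ 1 1] : Matrix (Fin 3) (Fin 3) E) L₃ →
          mapGL (endoGL (γ₂, u)) L₃ = L₃ → ∀ b : ℕ, (∀ c : E, (Pi.single 1 c : Fin 3 → E) ∈ L₃ ↔ Valued.v c ≤ Valued.v ϖ ^ b) → b ≤ R)
        (_hJ : ¬ IsOrd ρ α (jE ϖ ^ (J + 1)) lam) (_hfinLS : ∀ j a, (levelSet ρ Θ α (jE ϖ) h j a).Finite)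
        (_hf : ∀ (b j : ℕ) (Λ : AddSubgroup M) (x₀ : M) (r : E), 1 ≤ b → x₀ ≠ 0 → (∀ x, x ∈ Λ ↔ ∃ z, IsOrd ρ α (jE ϖ ^ j) z ∧ x = x₀ * z) →
          IsOrd ρ α (jE ϖ ^ j) (dualGen ρ Θ α (jE ϖ ^ j) h x₀) → ¬ IsOrd ρ α (jE ϖ ^ j) (dualGen ρ Θ α (jE ϖ ^ j) h x₀ / jE ϖ) → Valued.v (dualGen ρ Θ α (jE ϖ ^ j) h x₀) = Valued.v (jE ϖ) ^ b →
          (∀ b', (∀ x ∈ Λ, Valued.v (h * Θ x * b' + ρ (h * Θ x * b')) ≤ 1) → (lam - jE ((u : Matrix (Fin 1) (Fin 1) E) 0 0)) * b' ∈ Λ) → IsOrd ρ α (jE ϖ ^ j) lam →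
          jE r = glueUnit ρ Θ α (jE ϖ ^ j) h (jE ϖ) (jE hW) x₀ b →
          f b j Λ = Nat.card {x : 𝒪[E] ⧸ 𝓂[E] ^ (2 * b) // ∃ u' : 𝒪[E], Ideal.Quotient.mk (𝓂[E] ^ (2 * b)) u' = x ∧ Valued.v ((u' : E) * σ u' - r) ≤ Valued.v (ϖ ^ (2 * b))}),
        ∀ j b : ℕ, 1 ≤ b → b ≤ j → m < 4 * b → jl + 2 * b = 2 * j + dρ + m → 2 * b + mcOfRecord d ≤ m →
          (j + 1 = b + s0) → 2 * mstarOfRecord d + 2 * b ≤ m → IsOrd ρ α (jE ϖ ^ j) lam →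
                ((∑ᶠ Λ ∈ levelSetDep ρ Θ α (jE ϖ) h j b (lam - jE ((u : Matrix (Fin 1) (Fin 1) E) 0 0)) ∩
                      {Λ | ∃ B : Submodule 𝒪[E] (Fin 2 → E), B.toAddSubgroup.map φ = Λ ∧
                        ∃ L₃ : Submodule 𝒪[E] (Fin 3 → E), IsSelfDualLattice σ ϖ (!![H₂ 0 0, 0, H₂ 0 1; 0, hW, 0; H₂ 1 0, 0, H₂ 1 1] : Matrix (Fin 3) (Fin 3) E) L₃ ∧
                          L₃ ⊓ LinearMap.ker ((LinearMap.proj (1 : Fin 3) : (Fin 3 → E) →ₗ[E] E).restrictScalars 𝒪[E]) =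
                            B.map ((Matrix.toLin' (!![1, 0; 0, 0; 0, 1] : Matrix (Fin 3) (Fin 2) E)).restrictScalars 𝒪[E]) ∧
                          (∀ c : E, (Pi.single 1 c : Fin 3 → E) ∈ L₃ ↔ Valued.v c ≤ Valued.v ϖ ^ b) ∧
                          ((LatticeInLevel ϖ (d % 2) ((((endoGL (γ₂, u) : GL (Fin 3) E) : Matrix (Fin 3) (Fin 3) E) - 1)) L₃ ∧
                            ¬ LatticeInLevel ϖ (d % 2 + 1) ((((endoGL (γ₂, u) : GL (Fin 3) E) : Matrix (Fin 3) (Fin 3) E) - 1)) L₃) ∧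
                            {z : E | ∃ y ∈ L₃, Valued.v ((ϖ ^ (mstarOfRecord d))⁻¹ * (z - pairing σ (!![H₂ 0 0, 0, H₂ 0 1; 0, hW, 0; H₂ 1 0, 0, H₂ 1 1] : Matrix (Fin 3) (Fin 3) E) y (((((endoGL (γ₂, u) : GL (Fin 3) E) : Matrix (Fin 3) (Fin 3) E) - 1)) *ᵥ y))) ≤ 1} =
                              valueSetMod σ ϖ (mstarOfRecord d) (xPlus σ ϖ d))}, f b j Λ : ℕ) : ℤ) -
                  ((∑ᶠ Λ ∈ levelSetDep ρ Θ α (jE ϖ) h j b (lam - jE ((u : Matrix (Fin 1) (Fin 1) E) 0 0)) ∩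
                      {Λ | ∃ B : Submodule 𝒪[E] (Fin 2 → E), B.toAddSubgroup.map φ = Λ ∧
                        ∃ L₃ : Submodule 𝒪[E] (Fin 3 → E), IsSelfDualLattice σ ϖ (!![H₂ 0 0, 0, H₂ 0 1; 0, hW, 0; H₂ 1 0, 0, H₂ 1 1] : Matrix (Fin 3) (Fin 3) E) L₃ ∧
                          L₃ ⊓ LinearMap.ker ((LinearMap.proj (1 : Fin 3) : (Fin 3 → E) →ₗ[E] E).restrictScalars 𝒪[E]) =
                            B.map ((Matrix.toLin' (!![1, 0; 0, 0; 0, 1] : Matrix (Fin 3) (Fin 2) E)).restrictScalars 𝒪[E]) ∧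
                          (∀ c : E, (Pi.single 1 c : Fin 3 → E) ∈ L₃ ↔ Valued.v c ≤ Valued.v ϖ ^ b) ∧
                          ((LatticeInLevel ϖ (d % 2) ((((endoGL (γ₂, u) : GL (Fin 3) E) : Matrix (Fin 3) (Fin 3) E) - 1)) L₃ ∧
                            ¬ LatticeInLevel ϖ (d % 2 + 1) ((((endoGL (γ₂, u) : GL (Fin 3) E) : Matrix (Fin 3) (Fin 3) E) - 1)) L₃) ∧
                            ¬ {z : E | ∃ y ∈ L₃, Valued.v ((ϖ ^ (mstarOfRecord d))⁻¹ * (z - pairing σ (!![H₂ 0 0, 0, H₂ 0 1; 0, hW, 0; H₂ 1 0, 0, H₂ 1 1] : Matrix (Fin 3) (Fin 3) E) y (((((endoGL (γ₂, u) : GL (Fin 3) E) : Matrix (Fin 3) (Fin 3) E) - 1)) *ᵥ y))) ≤ 1} =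
                              valueSetMod σ ϖ (mstarOfRecord d) (xPlus σ ϖ d))}, f b j Λ : ℕ) : ℤ) = 0 := by
  intro E M _ _ _ _ _ _ _ _ _ _ σ ϖ d tE _hD _hσσ _h2 jE ρ Θ α lam _hρρ _hvρ _hρj _hjv _hjfix _hΘj _hΘΘ _hΘρ _hvΘ _hα _hα1 _hint _hΘlam _hvlam _hbasis _hC ϖM c₀ n₀ dρ dΘ dτ g s0 dK d'
    _c1 _c2 _c3 _c4 _c5 _c6 _c7 _c8 _c9 _c10 _c11 _c12 _c13 _c14 _c15 _c16 _c17 _c18 _c19 _c20 _c21 _c22 _c23 _c24 _c25 _c26 _c27 _c28 _c29 _hjpow _hEval _hϖmax γ₂ u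
    _hdet _htr _hirr _hlam2 _hρlam m jl _hm _hjl _hs _hp _hNm _hu1N _hlam1 _hu _hum H₂ hW _hH₂ _hH₂σ _hhW _hhWσ P₁ _hA _hΓ φ h _hφs _hφi _hφo _hφγ _hform _hΘh _hh J R f _hfinF _hR _hJ
    _hfinLS _hf j b hb1 hbj h4bm hline hlow hpar hray hlamj
  -- the E-datum, basic sizes
  obtain ⟨hσ, hvσ, hϖ, hfixE, hd, hd1, -⟩ := id _hD
  have hvϖ0 : Valued.v ϖ ≠ 0 := (by rw [hϖ]; exact exp_ne_zero); have hϖ0 : ϖ ≠ 0 := fun h0 => hvϖ0 (by rw [h0, map_zero])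
  have hϖlt : Valued.v ϖ < 1 := by rw [hϖ, ← exp_zero, exp_lt_exp]; norm_num
  have hϖle : Valued.v ϖ ≤ 1 := hϖlt.le
  have hPnE : ∀ n : ℕ, Valued.v ϖ ^ n = exp (-(n : ℤ)) := fun n => by rw [hϖ, ← exp_nsmul]; congr 1; simp
  -- the lane-C dictionary: `|jE ϖ| = e^{−2}`, `|α − ρα| = e^{−d_ρ}`, `m = 2mE`, `j = b + s0 + 2n`, `2d′ = d_ρ + 2s0`
  have hjϖ : Valued.v (jE ϖ) = exp (-2 : ℤ) := by rw [_c1, hϖ, ← exp_nsmul]; congr 1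
  have hjϖ0 : jE ϖ ≠ 0 := (map_ne_zero jE).2 hϖ0; have hvjϖ0 : Valued.v (jE ϖ) ≠ 0 := (Valuation.ne_zero_iff _).2 hjϖ0
  have hjϖlt : Valued.v (jE ϖ) < 1 := (by rw [hjϖ, ← exp_zero, exp_lt_exp]; norm_num); have hjϖle : Valued.v (jE ϖ) ≤ 1 := hjϖlt.le
  have hPn : ∀ n : ℕ, Valued.v (jE ϖ) ^ n = exp (-(2 * (n : ℤ))) := fun n => by
    rw [hjϖ, ← exp_nsmul]; congr 1; simp only [nsmul_eq_mul]; ring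
  have hαρ : Valued.v (α - ρ α) = exp (-(dρ : ℤ)) := by rw [_c6, _c7.2.2.2.2.1, _c5, ← exp_nsmul]; simp
  have hms : mstarOfRecord d = d % 2 + 2 * d - 1 := rfl
  have hnmc : 3 * d - 2 + d % 2 = mcOfRecord d := by rw [show mcOfRecord d = 2 * ((mstarOfRecord d + d) / 2) from rfl, hms]; omega
  have hNfl : 2 * mcOfRecord d ≤ N d tE := hN d tE
  have hmcN : 2 * mcOfRecord d ≤ m := hNfl.trans _hNm
  have hm2 : m % 2 = 0 :=
    depth_even_of_letters_ramM jE _hΘj _c8 _c21 _hΘlam (line_entry_mul_map_eq_one σ (fun h0 => by rw [h0, map_zero] at _hhW; exact zero_ne_one _hhW) _hA _hΓ) _hm (by omega)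
  obtain ⟨mE, hmE⟩ : ∃ mE : ℕ, m = 2 * mE := ⟨m / 2, by omega⟩
  have hds : 2 * d' = dρ + 2 * s0 := by have e1 := _c29; have e2 := _c22; omega
  have h2v : Valued.v (2 : E) < 1 := v_two_lt_one_of_not_isUnit_two _h2
  have hhW0 : hW ≠ 0 := fun h0 => by rw [h0, map_zero] at _hhW; exact zero_ne_one _hhW
  have huu := line_entry_mul_map_eq_one σ hhW0 _hA _hΓ
  have hhW1 : Valued.v (jE hW) = 1 := (v_map_eq_one_iff jE _hjv hW).2 _hhW
  have hdb : d ≤ b := (by omega); have hb2d : 2 * d - 1 ≤ b := by omega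
  have h2d1 : Valued.v ϖ ^ (2 * d - 1) < 1 := pow_lt_one₀ zero_le hϖlt (by omega); have hj2d1 : Valued.v (jE ϖ) ^ (2 * d - 1) < 1 := pow_lt_one₀ zero_le hjϖlt (by omega)
  -- the order parameter and the multiplier
  have hccv : Valued.v (jE ϖ ^ j * (α - ρ α)) = exp (-(2 * (j : ℤ) + dρ)) := by
    rw [Valuation.map_mul, hαρ, Valuation.map_pow, hPn, ← exp_add]; congr 1; ring
  have hcc : jE ϖ ^ j * (α - ρ α) ≠ 0 := fun h0 => by rw [h0, map_zero] at hccv; exact exp_ne_zero hccv.symm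
  have hμρ : ρ (lam - jE ((u : Matrix (Fin 1) (Fin 1) E) 0 0)) ≠ lam - jE ((u : Matrix (Fin 1) (Fin 1) E) 0 0) := fun h0 => by
    have h1 := _hjl
    rw [h0, sub_self, map_zero] at h1; exact exp_ne_zero h1.symm
  have hskew : lam - ρ lam = (lam - jE ((u : Matrix (Fin 1) (Fin 1) E) 0 0)) - ρ (lam - jE ((u : Matrix (Fin 1) (Fin 1) E) 0 0)) := by
    rw [map_sub, _hρj]; ring
  have hμv : Valued.v (lam - jE ((u : Matrix (Fin 1) (Fin 1) E) 0 0)) = Valued.v (jE ϖ) ^ mE := by rw [_hm, hPn]; congr 1; omega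
  -- the empty cell
  by_cases hempty : levelSet ρ Θ α (jE ϖ) h j b = ∅
  · have h0 : levelSetDep ρ Θ α (jE ϖ) h j b (lam - jE ((u : Matrix (Fin 1) (Fin 1) E) 0 0)) = ∅ :=
      Set.subset_eq_empty (levelSetDep_subset ρ Θ α (jE ϖ) h j b _) hempty
    rw [h0, Set.empty_inter, Set.empty_inter, finsum_mem_empty, Nat.cast_zero, sub_self]
  -- the class letters (★ G1, ★ F4), the reference pair (★ G1), the cell letters (★ G4)
  have hFgap := fgap_of_fixedFixed (ρ := ρ) (Θ := Θ) _c19 hjϖ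
  have hdeep2 := deep_of_datum (ρ := ρ) _hD jE _hjv _hjfix _hΘj (n := 2 * d) (by omega)
  have hdeep1 := deep_of_datum (ρ := ρ) _hD jE _hjv _hjfix _hΘj (n := 2 * d - 1) le_rfl
  have hdeepb := deep_of_datum (ρ := ρ) _hD jE _hjv _hjfix _hΘj (n := b) hb2d
  obtain ⟨c₀', -, hc₀1, -, hdich⟩ := dich_of_datum _c8
  obtain ⟨κ₀, ξ₀, hκ₀, hΘκ₀, hξ, hΘξ, hξ0, hκ₀e, hξv⟩ := exists_refPair_ramM _hρρ _hvρ _hΘΘ _hΘρ _hvΘ _c5 _c28 0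
  obtain ⟨hκ₀lt, hRd, hR⟩ := refPair_diag_sizes (ρ := ρ) (α := α) hjϖ hαρ hds hκ₀e hξv hb1 hpar
  have hκ₀v : Valued.v κ₀ ≤ Valued.v ξ₀ := hκ₀lt.le
  have hlam3 : Valued.v (lam - 1) ≤ Valued.v (jE ϖ) ^ (3 * d - 2) :=
    _hlam1.trans (by rw [Valuation.map_pow]; exact pow_le_pow_right_of_le_one' hjϖle (by omega))
  have hκc : Valued.v (ρ (lam - jE ((u : Matrix (Fin 1) (Fin 1) E) 0 0)) / (ρ (lam - jE ((u : Matrix (Fin 1) (Fin 1) E) 0 0)) - (lam - jE ((u : Matrix (Fin 1) (Fin 1) E) 0 0)))) =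
      Valued.v ξ₀ * Valued.v (jE ϖ) := by
    rw [v_centre_eq _hvρ, _hm, _hjl, hξv, hjϖ, ← exp_sub, ← exp_add]; congr 1; omega
  obtain ⟨W, BE, γ₁, W₁, hWc, hBE, hσγ, hσW₁, hθ, hWW, hγn, hγ1, hγr, hγe, hW₁1⟩ :=
    exists_cellLetters_of_tokens_diag (ρ := ρ) (Θ := Θ) (b := b) _hD jE _hjv _hjfix _hΘj _hρρ _hvρ _hΘρ _hΘlam _hvlam _hdet _hlam2 _hρlam hlam3 huu _hu hμv hμρ
      (by omega) (by omega) (by omega) hκ₀ hΘκ₀ hξ hΘξ hξ0 hκ₀v hκc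
  -- sizes in the cell currency
  have hul : Valued.v ((u : Matrix (Fin 1) (Fin 1) E) 0 0 - 1) ≤ Valued.v (ϖ ^ (d % 2 + 1)) :=
    _hum.trans (by rw [Valuation.map_pow, Valuation.map_pow]; exact pow_le_pow_right_of_le_one' hϖle (by omega))
  have hlam1 : Valued.v (lam - 1) ≤ Valued.v (jE ϖ) ^ (d % 2 + 1) :=
    _hlam1.trans (by rw [Valuation.map_pow]; exact pow_le_pow_right_of_le_one' hjϖle (by omega))
  have hlamρ : Valued.v (lam - ρ lam) ≤ Valued.v (jE ϖ ^ j * (α - ρ α)) * Valued.v (jE ϖ) ^ (d % 2 + 1) := by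
    rw [hskew, _hjl, hccv, hPn, ← exp_add, exp_le_exp]; omega
  have hμl : Valued.v (lam - jE ((u : Matrix (Fin 1) (Fin 1) E) 0 0)) ≤ Valued.v (jE ϖ) ^ (d % 2 + 1) * Valued.v (jE ϖ) ^ b := by
    rw [_hm, hPn, hPn, ← exp_add, exp_le_exp]; omega
  have hμY : Valued.v (lam - jE ((u : Matrix (Fin 1) (Fin 1) E) 0 0)) ≤ Valued.v (jE ϖ) ^ b := by rw [_hm, hPn, exp_le_exp]; omega
  have hμs : Valued.v (lam - jE ((u : Matrix (Fin 1) (Fin 1) E) 0 0)) ≤ Valued.v (jE ϖ) ^ (mE - b) := by rw [_hm, hPn, exp_le_exp]; omega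
  have hantis : Valued.v ((lam - jE ((u : Matrix (Fin 1) (Fin 1) E) 0 0)) - ρ (lam - jE ((u : Matrix (Fin 1) (Fin 1) E) 0 0))) ≤
      Valued.v (jE ϖ ^ j * (α - ρ α)) * Valued.v (jE ϖ) ^ (mE - b) := by
    rw [_hjl, hccv, hPn, ← exp_add, exp_le_exp]; omega
  have hμt := isOrd_div_pow_of_le (α := α) (_hρj ϖ) hjϖ0 (mE - b) hμs hantis
  have hμeq : lam - jE ((u : Matrix (Fin 1) (Fin 1) E) 0 0) = jE (ϖ ^ (mE - b)) * ((lam - jE ((u : Matrix (Fin 1) (Fin 1) E) 0 0)) / jE ϖ ^ (mE - b)) := by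
    rw [map_pow, mul_div_assoc', mul_div_cancel_left₀ _ (pow_ne_zero _ hjϖ0)]
  have hmm : mstarOfRecord d ≤ mE - b := by omega
  have hlamn : Valued.v (lam - 1) ≤ Valued.v (jE ϖ) ^ mcOfRecord d :=
    _hlam1.trans (by rw [Valuation.map_pow]; exact pow_le_pow_right_of_le_one' hjϖle (by omega))
  have hun : Valued.v ((u : Matrix (Fin 1) (Fin 1) E) 0 0 - 1) ≤ Valued.v ϖ ^ mcOfRecord d :=
    _hu1N.trans (by rw [Valuation.map_pow]; exact pow_le_pow_right_of_le_one' hϖle (by omega))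
  have hskb : Valued.v (lam - jE ((u : Matrix (Fin 1) (Fin 1) E) 0 0)) * Valued.v (lam - ρ lam) ≤
      Valued.v (jE ϖ) ^ mcOfRecord d * Valued.v (jE ϖ ^ j * (α - ρ α)) * Valued.v (jE ϖ) ^ b := by
    rw [hskew, _hm, _hjl, hccv, hPn, hPn, ← exp_add, ← exp_add, ← exp_add, exp_le_exp]; omega
  -- `P = (ϖσϖ)^b`, `t₊`, the strict slope letter, the root ball
  have hP0 : (ϖ * σ ϖ) ^ b ≠ 0 := pow_ne_zero _ (mul_ne_zero hϖ0 ((map_ne_zero σ).2 hϖ0))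
  have hσP : σ ((ϖ * σ ϖ) ^ b) = (ϖ * σ ϖ) ^ b := by rw [map_pow, map_mul, hσ, mul_comm (σ ϖ) ϖ]
  have htpv := v_refSkew_eq hvσ hϖ hd
  have htp1 : Valued.v ((ϖ - σ ϖ) * ((ϖ * σ ϖ) ^ ((d - d % 2) / 2))⁻¹) ≤ 1 := by rw [htpv]; exact pow_le_one₀ zero_le hϖle
  have hWWt : Valued.v (γ₁ * (W - W₁)) * Valued.v ((ϖ - σ ϖ) * ((ϖ * σ ϖ) ^ ((d - d % 2) / 2))⁻¹) ≤ 1 := mul_le_one' (hWW.trans h2d1.le) htp1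
  have hγpos : (0 : ℤᵐ⁰) < Valued.v γ₁ := lt_of_lt_of_le zero_lt_one hγ1
  have hθlt : Valued.v (BE / ((ϖ * σ ϖ) ^ b * ((ϖ - σ ϖ) * ((ϖ * σ ϖ) ^ ((d - d % 2) / 2))⁻¹)) - γ₁) < Valued.v γ₁ :=
    hθ.trans_lt (by
      calc Valued.v γ₁ * Valued.v ϖ ^ (2 * d - 1) < Valued.v γ₁ * 1 := mul_lt_mul_of_pos_left h2d1 hγpos
        _ = Valued.v γ₁ := mul_one _)
  -- digit perturbations on `rE`-balls, `rE = |ϖ|^{b+1}`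
  have hball : ∀ Ve V₀ : E, Valued.v (Ve - V₀) ≤ Valued.v ϖ ^ (b + 1) →
      Valued.v (V₀ - Ve) ≤ Valued.v ϖ ^ (2 * d - 1) ∧ Valued.v (γ₁ * (V₀ - Ve)) ≤ Valued.v ϖ ^ (2 * d - 1) ∧ Valued.v (γ₁ * (V₀ - Ve)) < 1 ∧
        Valued.v (γ₁ * (V₀ - Ve)) * Valued.v ((ϖ - σ ϖ) * ((ϖ * σ ϖ) ^ ((d - d % 2) / 2))⁻¹) ≤ 1 := by
    intro Ve V₀ hle
    have h1 : Valued.v (V₀ - Ve) ≤ Valued.v ϖ ^ (b + 1) := by rw [← neg_sub, Valuation.map_neg]; exact hle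
    have h2 : Valued.v (γ₁ * (V₀ - Ve)) ≤ Valued.v ϖ ^ (2 * d - 1) := by
      rw [Valuation.map_mul]; exact (mul_le_mul' le_rfl h1).trans hγr
    exact ⟨h1.trans (pow_le_pow_right_of_le_one' hϖle (by omega)), h2, h2.trans_lt h2d1, mul_le_one' (h2.trans h2d1.le) htp1⟩
  -- the radii: `rM = |jEϖ|^{b+1}` on `M`, `rE = |ϖ|^{b+1}` on `E` (the diagonal's resolution)
  have hjr : ∀ a : E, Valued.v (jE a) ≤ Valued.v (jE ϖ) ^ (b + 1) ↔ Valued.v a ≤ Valued.v ϖ ^ (b + 1) := fun a => v_map_le_pow_iff jE _hjv hϖ0 a (b + 1)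
  have hjsub : ∀ V y : E, Valued.v (jE V - jE y) ≤ Valued.v (jE ϖ) ^ (b + 1) → Valued.v (V - y) ≤ Valued.v ϖ ^ (b + 1) := fun V y hle =>
    (hjr (V - y)).1 (by rw [map_sub]; exact hle)
  have hrad : Valued.v (jE ϖ) ^ b * Valued.v (jE ϖ) ^ b ≤ Valued.v (jE ϖ) ^ (b + 1) * (Valued.v ξ₀ * Valued.v (jE ϖ ^ j * (α - ρ α))) := by
    rw [hRd, hPn, hPn, hPn, ← exp_add, ← exp_add, exp_le_exp]; omega
  -- the class system of fixed digits modulo `rE`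
  obtain ⟨Rd, hRd1, hRd2, hRd3, -⟩ := exists_repr_fixedBall_card hσ hvσ hfixE hϖ hd (b + 1) 0
  simp only [Nat.mul_zero, pow_zero, Nat.add_zero] at hRd1 hRd2 hRd3
  -- ★ p863983 ∕ ★ G5's radii at `r = |jEϖ|^{b+1}`, `r₀ = |jEϖ|^b`
  have hrR : Valued.v (jE ϖ) ^ (b + 1) * Valued.v ξ₀ * Valued.v (jE ϖ ^ j * (α - ρ α)) < Valued.v (jE ϖ) ^ b := by
    rw [mul_assoc, hRd, hPn, hPn, hPn, ← exp_add, exp_lt_exp]; omega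
  have hr₀ : Valued.v (jE ϖ) ^ (b + 1) * Valued.v ξ₀ * Valued.v (jE ϖ ^ j * (α - ρ α)) ≤ Valued.v (jE ϖ) ^ b * Valued.v (jE ϖ) ^ b := by
    rw [mul_assoc, hRd, hPn, hPn, hPn, ← exp_add, ← exp_add, exp_le_exp]; omega
  -- «GEN6-fibre = GEN5-fibre over a digit satisfying the depth digit»
  have hfib : ∀ y : E, Valued.v (γ₁ * (y - W₁)) * Valued.v ((ϖ - σ ϖ) * ((ϖ * σ ϖ) ^ ((d - d % 2) / 2))⁻¹) ≤ 1 →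
      {Λ : AddSubgroup M | ∃ x₀ : M, (x₀ ≠ 0 ∧ (∀ x, x ∈ Λ ↔ ∃ ζ, IsOrd ρ α (jE ϖ ^ j) ζ ∧ x = x₀ * ζ) ∧
          IsOrd ρ α (jE ϖ ^ j) (dualGen ρ Θ α (jE ϖ ^ j) h x₀) ∧ ¬ IsOrd ρ α (jE ϖ ^ j) (dualGen ρ Θ α (jE ϖ ^ j) h x₀ / jE ϖ) ∧
          Valued.v (dualGen ρ Θ α (jE ϖ ^ j) h x₀) = Valued.v (jE ϖ) ^ b ∧
          (∀ b', (∀ x ∈ Λ, Valued.v (h * Θ x * b' + ρ (h * Θ x * b')) ≤ 1) → (lam - jE ((u : Matrix (Fin 1) (Fin 1) E) 0 0)) * b' ∈ Λ)) ∧ ((∃ e : M, ρ e = e ∧ e * Θ e = h * (x₀ * Θ x₀) + ρ (h * (x₀ * Θ x₀))) ↔ (∃ e : M, ρ e = e ∧ e * Θ e = -(h * ρ h * ((α - ρ α) * Θ (α - ρ α)) * jE hW))) ∧ Valued.v (((ρ (h * (x₀ * Θ x₀)) / (h * (x₀ * Θ x₀) + ρ (h * (x₀ * Θ x₀))) - κ₀)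 / ξ₀) - jE y) ≤ Valued.v (jE ϖ) ^ (b + 1)} =
      {Λ : AddSubgroup M | ∃ x₀ : M, (x₀ ≠ 0 ∧ (∀ x, x ∈ Λ ↔ ∃ ζ, IsOrd ρ α (jE ϖ ^ j) ζ ∧ x = x₀ * ζ) ∧
          IsOrd ρ α (jE ϖ ^ j) (dualGen ρ Θ α (jE ϖ ^ j) h x₀) ∧ ¬ IsOrd ρ α (jE ϖ ^ j) (dualGen ρ Θ α (jE ϖ ^ j) h x₀ / jE ϖ) ∧
          Valued.v (dualGen ρ Θ α (jE ϖ ^ j) h x₀) = Valued.v (jE ϖ) ^ b) ∧ ((∃ e : M, ρ e = e ∧ e * Θ e = h * (x₀ * Θ x₀) + ρ (h * (x₀ * Θ x₀))) ↔ (∃ e : M, ρ e = e ∧ e * Θ e = -(h * ρ h * ((α - ρ α) * Θ (α - ρ α)) * jE hW))) ∧ Valued.v (((ρ (h * (x₀ * Θ x₀)) / (h * (x₀ * Θ x₀) + ρ (h * (x₀ * Θ x₀))) - κ₀) / ξ₀) - jE y) ≤ Valued.v (jE ϖ) ^ (b + 1)} := by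
    intro y hy
    ext Λ
    constructor
    · rintro ⟨x₀, ⟨hx₀, hΛx, hyO, hyp, hylev, -⟩, hC, hnear⟩
      exact ⟨x₀, ⟨hx₀, hΛx, hyO, hyp, hylev⟩, hC, hnear⟩
    · rintro ⟨x₀, hG5, hC, hnear⟩
      obtain ⟨w₀, V, hw₀Y, -, -, hjV, hκ, -, hpwP⟩ := exists_vertexFrame_of_gen (α := α) _hD jE _hjv _hjfix _hΘj _hρρ _hvρ _hΘΘ _hΘρ _hvΘ _hΘh _hh _hH₂σ
        φ _hφo _hform hb1 hcc hFgap hκ₀ hΘκ₀ hξ hΘξ hξ0 hκ₀v hR Λ x₀ hG5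
      have hVy : Valued.v (V - y) ≤ Valued.v ϖ ^ (b + 1) := hjsub V y (by rw [hjV]; exact hnear)
      have hdepV : Valued.v (γ₁ * (V - W₁)) * Valued.v ((ϖ - σ ϖ) * ((ϖ * σ ϖ) ^ ((d - d % 2) / 2))⁻¹) ≤ 1 := (ball_mul_iff_of_near (hball V y hVy).2.2.2).2 hy
      exact ⟨x₀, ⟨hG5.1, hG5.2.1, hG5.2.2.1, hG5.2.2.2.1, hG5.2.2.2.2,
        (dep_iff_ball _hD jE _hjv _hjfix _hρρ _hvρ _hα _hα1 _hint _hΘΘ _hΘρ _hvΘ _hΘh _hh H₂ φ _hform hcc hμρ hμY Λ x₀ hG5 hw₀Y hκ hWc hBE hP0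
          hpwP hθlt hWWt).2 hdepV⟩, hC, hnear⟩
  -- ★ p864732, the count socket with radii
  refine cellDiff_eq_zero_of_fibration_reads₄_radii σ hσ hvσ hϖ _hD h2v _hH₂σ _hhW _hhWσ jE _hρρ _hvρ _hα _hα1 _hint _hΘΘ _hΘρ _hvΘ _hΘj _hjv _hjfix _hjpow
    _hϖmax φ _hφs _hφi _hφo _hφγ _hvlam _hΘh _hh _hform ((u : Matrix (Fin 1) (Fin 1) E) 0 0) hb1 hdb hlamj f _hf (Valued.v (jE ϖ) ^ (b + 1)) (Valued.v ϖ ^ (b + 1)) hjr (_hfinLS j b)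
    (fun x₀ => (∃ e : M, ρ e = e ∧ e * Θ e = h * (x₀ * Θ x₀) + ρ (h * (x₀ * Θ x₀)))) (fun x₀ => ((ρ (h * (x₀ * Θ x₀)) / (h * (x₀ * Θ x₀) + ρ (h * (x₀ * Θ x₀))) - κ₀) / ξ₀)) (∃ e : M, ρ e = e ∧ e * Θ e = -(h * ρ h * ((α - ρ α) * Θ (α - ρ α)) * jE hW)) Rd hRd2 hRd3
    (fun V => ((Valued.v (κ₀ + jE V * ξ₀) * Valued.v (jE ϖ ^ j * (α - ρ α)) = Valued.v (jE ϖ) ^ b ∧ ∃ e : M, ρ e = e ∧ e * Θ e = (κ₀ + jE V * ξ₀) * ρ (κ₀ + jE V * ξ₀) / (h * ρ h)) ∧ Valued.v (γ₁ * (V - W₁)) * Valued.v ((ϖ - σ ϖ) * ((ϖ * σ ϖ) ^ ((d - d % 2) / 2))⁻¹) ≤ 1)) (fun V => (Valued.v (γ₁ * (V - W₁)) = 1)) (fun V => (Valued.v (γ₁ * (V - W₁)) = 1 → normSign σ (γ₁ * (V - W₁)) = normSign σ (-hW))) ?_ ?_ ?_ ?_ ?_ ?_ ?_ _ _ ?_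 ?_ ?_
  · -- hI: ★ P6′ generator independence at the intrinsic radius `r = |jEϖ|^{b+1}`
    intro Λ x₀ x₀' hG hG'
    exact cls_iff_cls_and_v_sub_le_of_gen_of_radius _hD jE _hjv _hjfix _hΘj _hρρ _hvρ _hΘΘ _hΘρ _hvΘ _hα _hα1 _hint _hΘh hb1 hdb hbj hcc hFgap hdeep2 κ₀ hξ0
      (Valued.v (jE ϖ) ^ (b + 1)) hrad Λ x₀ x₀' ⟨hG.1, hG.2.1, hG.2.2.1, hG.2.2.2.1, hG.2.2.2.2.1⟩ ⟨hG'.1, hG'.2.1, hG'.2.2.1, hG'.2.2.2.1, hG'.2.2.2.2.1⟩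
  · -- hV: the digit of a member (★ G2)
    intro Λ x₀ hG
    obtain ⟨w₀, V, -, hσV, hV1, hjV, -⟩ := exists_vertexFrame_of_gen (α := α) _hD jE _hjv _hjfix _hΘj _hρρ _hvρ _hΘΘ _hΘρ _hvΘ _hΘh _hh _hH₂σ φ _hφo _hform
      hb1 hcc hFgap hκ₀ hΘκ₀ hξ hΘξ hξ0 hκ₀v hR Λ x₀ ⟨hG.1, hG.2.1, hG.2.2.1, hG.2.2.2.1, hG.2.2.2.2.1⟩
    exact ⟨V, hjV, hσV, hV1⟩
  · -- hLit: a digit near a member is a literal digit (★ p863983) and satisfies the depth digit (★ G2 + ★ `dep_iff_ball` + ★ W1 §2)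
    intro Λ x₀ V₀ hG hV₀R hnear
    obtain ⟨hx₀, hΛx, hyO, hyp, hylev, hdep⟩ := hG
    refine ⟨lit_of_near_of_gen _hD jE _hjv _hjfix _hΘj _hρρ _hvρ _hΘΘ _hΘρ _hΘh _hh hb1 hcc hFgap hκ₀ hΘκ₀ hξ hΘξ hξ0 hrR hr₀ hdeepb Λ x₀
      ⟨hx₀, hΛx, hyO, hyp, hylev⟩ V₀ (hRd1 V₀ hV₀R).1 hnear, ?_⟩
    obtain ⟨w₀, V, hw₀Y, -, -, hjV, hκ, -, hpwP⟩ := exists_vertexFrame_of_gen (α := α) _hD jE _hjv _hjfix _hΘj _hρρ _hvρ _hΘΘ _hΘρ _hvΘ _hΘh _hh _hH₂σ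
      φ _hφo _hform hb1 hcc hFgap hκ₀ hΘκ₀ hξ hΘξ hξ0 hκ₀v hR Λ x₀ ⟨hx₀, hΛx, hyO, hyp, hylev⟩
    have hdepV : Valued.v (γ₁ * (V - W₁)) * Valued.v ((ϖ - σ ϖ) * ((ϖ * σ ϖ) ^ ((d - d % 2) / 2))⁻¹) ≤ 1 :=
      (dep_iff_ball _hD jE _hjv _hjfix _hρρ _hvρ _hα _hα1 _hint _hΘΘ _hΘρ _hvΘ _hΘh _hh H₂ φ _hform hcc hμρ hμY Λ x₀ ⟨hx₀, hΛx, hyO, hyp, hylev⟩ hw₀Y hκ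
        hWc hBE hP0 hpwP hθlt hWWt).1 hdep
    have hVy : Valued.v (V - V₀) ≤ Valued.v ϖ ^ (b + 1) := hjsub V V₀ (by rw [hjV]; exact hnear)
    exact (ball_mul_iff_of_near (hball V V₀ hVy).2.2.2).1 hdepV
  · -- hNX: the sphere is constant on `rE`-balls (★ W1 §2)
    intro Ve V₀ _ _ _ hnear
    exact sphere_iff_of_near (hball Ve V₀ hnear).2.2.1
  · -- hψ: the sign implication is constant on `rE`-balls (★ W1 §2)
    intro Ve V₀ hσVe _ hV₀R hnear
    exact psi_iff_of_near _hD hσγ hσW₁ hσVe (hRd1 V₀ hV₀R).1 (hball Ve V₀ hnear).2.1 _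
  · -- hF: ★ G5 fibre count over literal digits at `r = |jEϖ|^{b+1}`, after GEN6-fibre = GEN5-fibre
    intro y hy y' hy'
    have hyL := (Finset.mem_filter.1 hy).2
    have hy'L := (Finset.mem_filter.1 hy').2
    rw [hfib y hyL.2, hfib y' hy'L.2]
    exact fibre_ncard_eq_of_lit_of_gen _hD jE hjϖlt _hjfix _hΘj _hρρ _hvρ _hΘΘ _hΘρ _hΘh _hh hb1 hcc hFgap (_hfinLS j b) hc₀1 hdich _c20 hκ₀ hΘκ₀ hξ
      hΘξ hξ0 hrR hr₀ hdeepb (∃ e : M, ρ e = e ∧ e * Θ e = -(h * ρ h * ((α - ρ α) * Θ (α - ρ α)) * jE hW)) Rd (fun V hV => (hRd1 V hV).1) _ (fun V _ hV => hV.1) y hy y' hy'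
  · -- hbase: ★ F1 digit balance on the sphere, with `C = LIT` (constant under the sphere's twists by ★ G3 + ★ W1 §2)
    have hC : ∀ V V' : E, σ V = V → Valued.v V ≤ 1 → σ V' = V' → Valued.v V' ≤ 1 → Valued.v (γ₁ * (V - W₁)) = 1 →
        Valued.v (γ₁ * (V' - V)) ≤ exp (-(2 * ((d - 1 : ℕ) : ℤ))) → (((Valued.v (κ₀ + jE V * ξ₀) * Valued.v (jE ϖ ^ j * (α - ρ α)) = Valued.v (jE ϖ) ^ b ∧ ∃ e : M, ρ e = e ∧ e * Θ e = (κ₀ + jE V * ξ₀) * ρ (κ₀ + jE V * ξ₀) / (h * ρ h)) ∧ Valued.v (γ₁ * (V - W₁)) * Valued.v ((ϖ - σ ϖ) * ((ϖ * σ ϖ) ^ ((d - d % 2) / 2))⁻¹) ≤ 1) ↔ ((Valued.v (κ₀ + jE V' * ξ₀) * Valued.v (jE ϖ ^ j * (α - ρ α)) = Valued.v (jE ϖ) ^ b ∧ ∃ e : M, ρ e = e ∧ e * Θ e = (κ₀ + jE V' * ξ₀) * ρ (κ₀ + jE V' * ξ₀) / (h * ρ h)) ∧ Valued.v (γ₁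 * (V' - W₁)) * Valued.v ((ϖ - σ ϖ) * ((ϖ * σ ϖ) ^ ((d - d % 2) / 2))⁻¹) ≤ 1)) := by
      intro V V' hσV _ hσV' _ _ hpert
      have h22 : exp (-(2 * ((d - 1 : ℕ) : ℤ))) = Valued.v ϖ ^ (2 * d - 2) := by rw [hPnE]; congr 1; omega
      rw [h22] at hpert
      have hVV : Valued.v (V' - V) ≤ Valued.v ϖ ^ (2 * d) := by
        have h1 : Valued.v γ₁ * Valued.v (V' - V) ≤ Valued.v γ₁ * Valued.v ϖ ^ (2 * d) := by
          rw [← Valuation.map_mul]; exact hpert.trans hγe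
        rcases le_or_gt (Valued.v (V' - V)) (Valued.v ϖ ^ (2 * d)) with h | h
        · exact h
        · exact absurd h1 (not_le.2 (mul_lt_mul_of_pos_left h hγpos))
      have hVVM : Valued.v (jE (V' - V)) * Valued.v ξ₀ * Valued.v (jE ϖ ^ j * (α - ρ α)) ≤ Valued.v (jE ϖ) ^ (2 * d - 1) * Valued.v (jE ϖ) ^ b := by
        rw [mul_assoc, hRd]
        calc Valued.v (jE (V' - V)) * Valued.v (jE ϖ) ^ (b - 1) ≤ Valued.v (jE ϖ) ^ (2 * d) * Valued.v (jE ϖ) ^ (b - 1) :=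
              mul_le_mul' ((v_map_le_pow_iff jE _hjv hϖ0 (V' - V) (2 * d)).2 hVV) le_rfl
          _ = Valued.v (jE ϖ) ^ (2 * d - 1) * Valued.v (jE ϖ) ^ b := by rw [← pow_add, ← pow_add]; congr 1; omega
      refine and_congr (litStar_iff_of_near_of_radius jE _hjfix _hΘj _hρρ _hvρ _hΘρ hκ₀ hΘκ₀ hξ hΘξ hjϖ0 hdeep1 hσV hσV' hVVM hj2d1) ?_
      exact ball_mul_iff_of_near (mul_le_one' (hpert.trans (pow_le_one₀ zero_le hϖle)) htp1)
    have hF1 := card_filter_sphere_plus_eq_card_filter_not _hD h2v hσγ hγ1 hσW₁ hW₁1 (n := b + 1) (ρ := mE - b - d % 2) hγn (by omega) Rd hRd1 hRd2 hRd3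
      (fun V => ((Valued.v (κ₀ + jE V * ξ₀) * Valued.v (jE ϖ ^ j * (α - ρ α)) = Valued.v (jE ϖ) ^ b ∧ ∃ e : M, ρ e = e ∧ e * Θ e = (κ₀ + jE V * ξ₀) * ρ (κ₀ + jE V * ξ₀) / (h * ρ h)) ∧ Valued.v (γ₁ * (V - W₁)) * Valued.v ((ϖ - σ ϖ) * ((ϖ * σ ϖ) ^ ((d - d % 2) / 2))⁻¹) ≤ 1)) hC (s₀ := normSign σ (-hW)) (normSign_eq_one_or σ (-hW))
    beta_reduce at hF1
    have hS : Rd.filter (fun V => (Valued.v (γ₁ * (V - W₁)) = 1) ∧ ((Valued.v (κ₀ + jE V * ξ₀) * Valued.v (jE ϖ ^ j * (α - ρ α)) = Valued.v (jE ϖ) ^ b ∧ ∃ e : M, ρ e = e ∧ e * Θ e = (κ₀ + jE V * ξ₀) * ρ (κ₀ + jE V * ξ₀) / (h * ρ h)) ∧ Valued.v (γ₁ * (V - W₁)) * Valued.v ((ϖ - σ ϖ) * ((ϖ * σ ϖ) ^ ((d - d % 2) / 2))⁻¹) ≤ 1)) = (Rd.filter (fun V => ((Valued.v (κ₀ + jE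 V * ξ₀) * Valued.v (jE ϖ ^ j * (α - ρ α)) = Valued.v (jE ϖ) ^ b ∧ ∃ e : M, ρ e = e ∧ e * Θ e = (κ₀ + jE V * ξ₀) * ρ (κ₀ + jE V * ξ₀) / (h * ρ h)) ∧ Valued.v (γ₁ * (V - W₁)) * Valued.v ((ϖ - σ ϖ) * ((ϖ * σ ϖ) ^ ((d - d % 2) / 2))⁻¹) ≤ 1))).filter (fun V => (Valued.v (γ₁ * (V - W₁)) = 1)) := by
      ext V
      simp only [Finset.mem_filter]
      exact ⟨fun hV => ⟨⟨hV.1, hV.2.2⟩, hV.2.1⟩, fun hV => ⟨hV.1.1, hV.2, hV.1.2⟩⟩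
    rw [hS] at hF1
    have e1 : ((Rd.filter (fun V => ((Valued.v (κ₀ + jE V * ξ₀) * Valued.v (jE ϖ ^ j * (α - ρ α)) = Valued.v (jE ϖ) ^ b ∧ ∃ e : M, ρ e = e ∧ e * Θ e = (κ₀ + jE V * ξ₀) * ρ (κ₀ + jE V * ξ₀) / (h * ρ h)) ∧ Valued.v (γ₁ * (V - W₁)) * Valued.v ((ϖ - σ ϖ) * ((ϖ * σ ϖ) ^ ((d - d % 2) / 2))⁻¹) ≤ 1))).filter (fun V => (Valued.v (γ₁ * (V - W₁)) = 1))).filter (fun V => (Valued.v (γ₁ * (V - W₁)) = 1 → normSign σ (γ₁ * (V - W₁)) = normSign σ (-hW))) =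
        ((Rd.filter (fun V => ((Valued.v (κ₀ + jE V * ξ₀) * Valued.v (jE ϖ ^ j * (α - ρ α)) = Valued.v (jE ϖ) ^ b ∧ ∃ e : M, ρ e = e ∧ e * Θ e = (κ₀ + jE V * ξ₀) * ρ (κ₀ + jE V * ξ₀) / (h * ρ h)) ∧ Valued.v (γ₁ * (V - W₁)) * Valued.v ((ϖ - σ ϖ) * ((ϖ * σ ϖ) ^ ((d - d % 2) / 2))⁻¹) ≤ 1))).filter (fun V => (Valued.v (γ₁ * (V - W₁)) = 1))).filter (fun V => normSign σ (γ₁ * (V - W₁)) = normSign σ (-hW)) :=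
      Finset.filter_congr fun V hV => by
        have hN : (Valued.v (γ₁ * (V - W₁)) = 1) := (Finset.mem_filter.1 hV).2
        exact ⟨fun hψ => hψ hN, fun hs _ => hs⟩
    have e2 : ((Rd.filter (fun V => ((Valued.v (κ₀ + jE V * ξ₀) * Valued.v (jE ϖ ^ j * (α - ρ α)) = Valued.v (jE ϖ) ^ b ∧ ∃ e : M, ρ e = e ∧ e * Θ e = (κ₀ + jE V * ξ₀) * ρ (κ₀ + jE V * ξ₀) / (h * ρ h)) ∧ Valued.v (γ₁ * (V - W₁)) * Valued.v ((ϖ - σ ϖ) * ((ϖ * σ ϖ) ^ ((d - d % 2) / 2))⁻¹) ≤ 1))).filter (fun V => (Valued.v (γ₁ * (V - W₁)) = 1))).filter (fun V => ¬ (Valued.v (γ₁ * (V - W₁)) = 1 → normSign σ (γ₁ * (V - W₁)) = normSign σ (-hW))) =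
        ((Rd.filter (fun V => ((Valued.v (κ₀ + jE V * ξ₀) * Valued.v (jE ϖ ^ j * (α - ρ α)) = Valued.v (jE ϖ) ^ b ∧ ∃ e : M, ρ e = e ∧ e * Θ e = (κ₀ + jE V * ξ₀) * ρ (κ₀ + jE V * ξ₀) / (h * ρ h)) ∧ Valued.v (γ₁ * (V - W₁)) * Valued.v ((ϖ - σ ϖ) * ((ϖ * σ ϖ) ^ ((d - d % 2) / 2))⁻¹) ≤ 1))).filter (fun V => (Valued.v (γ₁ * (V - W₁)) = 1))).filter (fun V => ¬ normSign σ (γ₁ * (V - W₁)) = normSign σ (-hW)) :=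
      Finset.filter_congr fun V hV => by
        have hN : (Valued.v (γ₁ * (V - W₁)) = 1) := (Finset.mem_filter.1 hV).2
        exact not_congr ⟨fun hψ => hψ hN, fun hs _ => hs⟩
    rw [e1, e2]; exact hF1
  · -- hP: the population read (★ R1b-A §3, lane-free)
    intro Λ x₀ hG
    exact weight_ne_zero_iff_cls_of_gen6 _hD h2v jE _hjv _hjfix _hΘj _hρρ _hvρ _hΘΘ _hΘρ _hvΘ _hΘh _hh hb1 hdb hcc hFgap _hhWσ hhW1 hlamj f _hf Λ x₀ hG
  · -- hL₁: the first literal read (★ G6′ at resolution `b + 1`)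
    intro Λ x₀ hG hfne
    exact (reads_of_gen6_of_radius _hD h2v jE _hjv _hjfix _hΘj _hjpow _hϖmax _hρρ _hvρ _hα _hα1 _hint _hΘΘ _hΘρ _hvΘ _hΘh _hh _hH₂ _hH₂σ _hhW _hhWσ φ _hφs _hφi
      _hφo _hφγ _hvlam _hΘlam _hform u huu hb1 hdb hcc hlamj f _hf hFgap hκ₀ hΘκ₀ hξ hΘξ hξ0 hκ₀v hR hrad hWc hBE hP0 hσP rfl hσγ hσW₁ hθ hWW hγr hul hlam1
      hlamρ hμl hμeq hμt hmm hnmc.le hlamn hun hskb hμρ Λ x₀ hG hfne).1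
  · -- hL₂: the second literal read (★ G6′ at resolution `b + 1`)
    intro Λ x₀ hG hfne
    exact (reads_of_gen6_of_radius _hD h2v jE _hjv _hjfix _hΘj _hjpow _hϖmax _hρρ _hvρ _hα _hα1 _hint _hΘΘ _hΘρ _hvΘ _hΘh _hh _hH₂ _hH₂σ _hhW _hhWσ φ _hφs _hφi
      _hφo _hφγ _hvlam _hΘlam _hform u huu hb1 hdb hcc hlamj f _hf hFgap hκ₀ hΘκ₀ hξ hΘξ hξ0 hκ₀v hR hrad hWc hBE hP0 hσP rfl hσγ hσW₁ hθ hWW hγr hul hlam1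
      hlamρ hμl hμeq hμt hmm hnmc.le hlamn hun hskb hμρ Λ x₀ hG hfne).2

end Summit.HodgeConjecture.HodgeConjecture.Cruxes.H413.F0P3cDyRamBeta2ConesOffRowCUpperRayDiag

end
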